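import Mathlib
import HarnessLib
import Literature.MathematicalPhysics.QuantumLattice.SectorisedKernelNormExtraction
import Summits.HubbardSuperconductivity.HubbardSuperconductivity.Theorems.KLProgrammeKLRegimeSplitPredicates

/-!
# Route `KLProgramme` — ENGINE child 19855, two-leg stubs: (E3d) FIELD STRENGTH from the TEMPORAL FIRST MOMENT of the position-space
# two-leg kernel — `|z(k⃗,σ) − 1| ≤ 2·M₁ᵗ` by Fourier inversion on the space-time lattice (generic in the Grassmann polynomial)

Cell `gate-hubbard-kl`, seat p1b (g6); TWO-LEG-CLOSERS.md §1 row (E3d) / §2 (M2).  The two-leg slot's (E3d) clause asks `|z_n(k⃗) − 1| ≤ cz|U|`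
where `z = fieldStrength` is the centred difference quotient of `Im Σ` over the two lowest frequencies `±ω₀ = ±π/β`
(`SymmetricRegimeFunctionals`).  The fermionic expansion bounds POSITION-SPACE kernels (`sectorisedKernel` / `positionKernel`, BGM (2.17));
this file is the bridge: for ANY `G : HubbardGrassmann L M` and `β > 0`,

  `‖Σ(ω₀,k⃗,σ) − Σ(−ω₀,k⃗,σ)‖ ≤ 4ω₀ · M₁ᵗ`,   `|z(k⃗,σ) − 1| ≤ 2 · M₁ᵗ`,

where `M₁ᵗ` is any bound on the temporal first moment of the (unsectorised) two-leg position kernel with leg `0` pinned: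
`ε_x Σ_{x₁} τ(x₀,x₁) ‖W₂(x₀⁺σ, x₁⁻σ)‖ ≤ M₁ᵗ` for every `x₀`, `τ(x₀,x₁) = ε_x · circDist_{2M}(t₀,t₁)` the imaginary-time torus distance
(`ε_x = β/(2M)`; the time part of the engine's `spaceTimeDist`).  Mechanism: by `sum_sectorisedKernel_mul_conj_prod` (Fourier inversion,
`SectorisedKernelNormExtraction`) `|Λ|²·F₂((K,σ,+),(K,σ,−)) = Σ_x W₂(x) e^{iK·(x₀−x₁)}`; the two frequencies differ by the factor
`e^{iω₀Δt} − e^{−iω₀Δt} = 2i sin(ω₀Δt)` with `|sin(ω₀Δt)| = |sin(π(t₀−t₁)/(2M))| ≤ π·circDist/(2M) = ω₀·τ`; `Σ = 2βL²·F₂`, `βL² = ε_x|Λ|`,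
and the average over `x₀` is below the sup.  No symmetry ((E0)) is used.

* §1 `norm_cexp_mul_I_sub_cexp_neg_mul_I` (`‖e^{iθ} − e^{−iθ}‖ = 2|sin θ|`), `abs_sin_pi_mul_sub_div_le_circDist` (the sine against the
  circle distance);
* §2 `card_sq_mul_kernel_two_eq_sum` (inversion for the two-leg coefficient with the trivial multiplier), the phase algebra, and
  **`norm_selfEnergy_omega0_sub_rev_le_of_time_moment`**;
* §3 **`abs_fieldStrengthSpin_sub_one_le_of_time_moment`**, `abs_fieldStrength_sub_one_le_of_time_moment`, and the slot-shaped corollary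
  for the scale-`n` action of the cell, `abs_klFieldStrength_sub_one_le_of_time_moment`.

Everything is PROVED; no definitions; nothing about the Hubbard model is asserted (the time-moment bound is a hypothesis — the engine's
output).  References: BGM 2006 §2.1 (2.4)–(2.5), §2.3 (2.17) [cite: BenfattoGiulianiMastropietro2006]; Salmhofer 1999 App. B.5.5.
-/

noncomputable section

namespace Summit.HubbardSuperconductivity.HubbardSuperconductivity.Theorems.TwoLegFourier

set_option linter.dupNamespace false -- summit = problem name (single-conjunct summit), D-0017

open Finset Complex
open Literature.MathematicalPhysics.QuantumLattice Literature.Probability.LatticeModels GrassmannAlgebra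
open Summit.HubbardSuperconductivity.HubbardSuperconductivity.Theorems.KLRegimeSplit

variable {L M : ℕ}

/-! ## §1 Two elementary estimates -/

/-- `‖e^{iθ} − e^{−iθ}‖ = 2|sin θ|`. -/
theorem norm_cexp_mul_I_sub_cexp_neg_mul_I (θ : ℝ) :
    ‖Complex.exp ((θ : ℂ) * I) - Complex.exp (-(θ : ℂ) * I)‖ = 2 * |Real.sin θ| := by
  have h : Complex.exp ((θ : ℂ) * I) - Complex.exp (-(θ : ℂ) * I) = 2 * Complex.sin θ * I := by
    have h2 := Complex.two_sin (θ : ℂ)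
    have hI : I * I = -1 := Complex.I_mul_I
    linear_combination (-I) * h2 + (Complex.exp ((θ : ℂ) * I) - Complex.exp (-(θ : ℂ) * I)) * hI
  rw [h, norm_mul, norm_mul, Complex.norm_I, mul_one, ← Complex.ofReal_sin, Complex.norm_real, Real.norm_eq_abs]
  simp

/-- `|sin|` is unchanged by an integer multiple of `π` in the argument. -/
theorem abs_sin_add_int_mul_pi (x : ℝ) (q : ℤ) : |Real.sin (x + q * Real.pi)| = |Real.sin x| := by
  rw [Real.sin_add_int_mul_pi, abs_mul, abs_zpow, abs_neg, abs_one, one_zpow, one_mul]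

/-- **The sine against the circle distance**: for `a, b < N`, `|sin(π (a − b)/N)| ≤ π · circDist N a b / N`. -/
theorem abs_sin_pi_mul_sub_div_le_circDist {N a b : ℕ} (hN : 0 < N) (ha : a < N) (hb : b < N) :
    |Real.sin (Real.pi * ((a : ℝ) - b) / N)| ≤ Real.pi * (circDist N a b : ℝ) / N := by
  have hNr : (0 : ℝ) < N := by exact_mod_cast hN
  have hb' : b % N = b := Nat.mod_eq_of_lt hb
  have ha' : a % N = a := Nat.mod_eq_of_lt ha
  set r := (a + N - b) % N with hr
  set r' := (b + N - a) % N with hr'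
  have hcd : circDist N a b = min r r' := by rw [circDist, hb', ha']
  -- `r = (a - b) + N q`, `r' = (b - a) + N q'` for integers `q, q'`
  have hq : ∃ q : ℤ, (r : ℝ) = ((a : ℝ) - b) + N * q := by
    have h1 : r + N * ((a + N - b) / N) = a + N - b := by rw [hr]; exact Nat.mod_add_div _ _
    have hle : b ≤ a + N := by omega
    have h1r : (r : ℝ) + N * (((a + N - b) / N : ℕ) : ℝ) = (a : ℝ) + N - b := by
      have := congrArg (Nat.cast : ℕ → ℝ) h1
      push_cast [Nat.cast_sub hle] at this
      linarith
    refine ⟨1 - ((a + N - b) / N : ℕ), ?_⟩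
    rw [Int.cast_sub, Int.cast_one, Int.cast_natCast]
    linarith
  have hq' : ∃ q : ℤ, (r' : ℝ) = ((b : ℝ) - a) + N * q := by
    have h1 : r' + N * ((b + N - a) / N) = b + N - a := by rw [hr']; exact Nat.mod_add_div _ _
    have hle : a ≤ b + N := by omega
    have h1r : (r' : ℝ) + N * (((b + N - a) / N : ℕ) : ℝ) = (b : ℝ) + N - a := by
      have := congrArg (Nat.cast : ℕ → ℝ) h1
      push_cast [Nat.cast_sub hle] at this
      linarith
    refine ⟨1 - ((b + N - a) / N : ℕ), ?_⟩
    rw [Int.cast_sub, Int.cast_one, Int.cast_natCast]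
    linarith
  -- at a residue `ρ = s + Nq`: `|sin(π s/N)| = |sin(π ρ/N)| ≤ π ρ / N`
  have key : ∀ (s : ℝ) (q : ℤ) (ρ : ℕ), (ρ : ℝ) = s + N * q → |Real.sin (Real.pi * s / N)| ≤ Real.pi * ρ / N := by
    intro s q ρ h
    have hper : Real.pi * ρ / N = Real.pi * s / N + q * Real.pi := by rw [h]; field_simp; try ring
    have h1 : |Real.sin (Real.pi * s / N)| = |Real.sin (Real.pi * ρ / N)| := by rw [hper, abs_sin_add_int_mul_pi]
    rw [h1]
    calc |Real.sin (Real.pi * ρ / N)| ≤ |Real.pi * ρ / N| := Real.abs_sin_le_abs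
      _ = Real.pi * ρ / N := abs_of_nonneg (by positivity)
  obtain ⟨q, hqe⟩ := hq
  obtain ⟨q', hqe'⟩ := hq'
  have hb1 : |Real.sin (Real.pi * ((a : ℝ) - b) / N)| ≤ Real.pi * r / N := key _ q r hqe
  have hb2 : |Real.sin (Real.pi * ((a : ℝ) - b) / N)| ≤ Real.pi * r' / N := by
    rw [show Real.pi * ((a : ℝ) - b) / N = -(Real.pi * ((b : ℝ) - a) / N) by ring, Real.sin_neg, abs_neg]
    exact key _ q' r' hqe'
  rw [hcd]
  rcases le_total r r' with h | h
  · rw [min_eq_left h]; exact hb1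
  · rw [min_eq_right h]; exact hb2

/-! ## §2 Fourier inversion for the two-leg coefficient and the two lowest frequencies -/

/-- The label string of the self-energy coefficient `Σ(K,σ) = 𝒱₂(ψ̂⁺_{Kσ}, ψ̂⁻_{Kσ})`. -/
theorem selfEnergy_eq_vertexFn (β : ℝ) (G : HubbardGrassmann L M) (K : FreqMomentum L M) (σ : Fin 2) :
    selfEnergy L M β G K σ = ((2 * (β * (L : ℝ) ^ 2) : ℝ) : ℂ) * kernel ℂ G 2 ![((K, σ), 0), ((K, σ), 1)] := by
  rw [selfEnergy, vertexFn_def]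
  norm_num [Nat.factorial]

/-- **Inversion for the two-leg coefficient** (trivial multiplier): with `W = sectorisedKernel β 1 G 2 ((σ,+),(σ,−))`,
`|Λ|²·F₂((K,σ,+),(K,σ,−)) = Σ_x W(x)·conj(e^{-iK·x₀} e^{+iK·x₁})`. -/
theorem card_sq_mul_kernel_two_eq_sum [NeZero L] {β : ℝ} (hβ : β ≠ 0) (G : HubbardGrassmann L M) (K : FreqMomentum L M) (σ : Fin 2) :
    (Fintype.card (SpaceTimeIdx L M) : ℂ) ^ 2 * kernel ℂ G 2 ![((K, σ), 0), ((K, σ), 1)] =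
      ∑ x : Fin 2 → SpaceTimeIdx L M,
        sectorisedKernel L M β (trivialMultiplier L M) G 2 (![((0, σ), 0), ((0, σ), 1)] : Fin 2 → SectorLeg 1) x *
          (starRingEnd ℂ) (hubbardPlaneWave L M β 0 K (x 0) * hubbardPlaneWave L M β 1 K (x 1)) := by
  have h := sum_sectorisedKernel_mul_conj_prod hβ (trivialMultiplier L M) G 2
    (![((0, σ), 0), ((0, σ), 1)] : Fin 2 → SectorLeg 1) ![K, K]
  have hX : (fun i : Fin 2 => (((![K, K] : Fin 2 → FreqMomentum L M) i,
      ((![((0, σ), 0), ((0, σ), 1)] : Fin 2 → SectorLeg 1) i).1.2), ((![((0, σ), 0), ((0, σ), 1)] : Fin 2 → SectorLeg 1) i).2))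
      = ![((K, σ), 0), ((K, σ), 1)] := by
    funext i; fin_cases i <;> rfl
  rw [hX] at h
  simp only [Fin.prod_univ_two, trivialMultiplier, mul_one, Matrix.cons_val_zero, Matrix.cons_val_one] at h
  rw [← h]

/-- The product of the two plane waves of the string `(K,+)(K,−)` is one exponential of the phase DIFFERENCE:
`e^{-iK·y} · e^{+iK·y′} = exp(i (K·y′ − K·y))`. -/
theorem hubbardPlaneWave_zero_mul_one (β : ℝ) (K : FreqMomentum L M) (y y' : SpaceTimeIdx L M) :
    hubbardPlaneWave L M β 0 K y * hubbardPlaneWave L M β 1 K y' =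
      Complex.exp (((spaceTimePhase L M β K y' - spaceTimePhase L M β K y : ℝ) : ℂ) * I) := by
  unfold hubbardPlaneWave chargeSign
  simp only [if_true, one_mul, show (1 : Fin 2) ≠ 0 from by decide, if_false, neg_mul, one_mul]
  rw [← Complex.exp_add]
  congr 1
  push_cast
  ring

/-- Its conjugate: `conj(e^{-iK·y} e^{+iK·y′}) = exp(i (K·y − K·y′))`. -/
theorem conj_hubbardPlaneWave_zero_mul_one [NeZero L] (β : ℝ) (K : FreqMomentum L M) (y y' : SpaceTimeIdx L M) :
    (starRingEnd ℂ) (hubbardPlaneWave L M β 0 K y * hubbardPlaneWave L M β 1 K y') =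
      Complex.exp (((spaceTimePhase L M β K y - spaceTimePhase L M β K y' : ℝ) : ℂ) * I) := by
  rw [hubbardPlaneWave_zero_mul_one, ← Complex.exp_conj, map_mul, Complex.conj_ofReal, Complex.conj_I]
  congr 1
  push_cast
  ring

/-- **The phase difference at `±ω₀` splits off the time phase**: for `K₊ = (ω₀, k⃗)` and `K₋ = (−ω₀, k⃗)`,
`K₊·y − K₊·y′ = θ + D` and `K₋·y − K₋·y′ = −θ + D` with `θ = (π/β)(t_y − t_{y′})` and the same spatial part `D`. -/
theorem spaceTimePhase_omega0_sub [NeZero M] (β : ℝ) (k : TorusSite 2 L) (y y' : SpaceTimeIdx L M) :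
    spaceTimePhase L M β (omega0 M, k) y - spaceTimePhase L M β (omega0 M, k) y' =
        Real.pi / β * (imagTime β M y.1 - imagTime β M y'.1) +
          (∑ i, latticeMomentum L k i * ((y.2 i).val : ℝ) - ∑ i, latticeMomentum L k i * ((y'.2 i).val : ℝ)) ∧
      spaceTimePhase L M β ((omega0 M).rev, k) y - spaceTimePhase L M β ((omega0 M).rev, k) y' =
        -(Real.pi / β * (imagTime β M y.1 - imagTime β M y'.1)) +
          (∑ i, latticeMomentum L k i * ((y.2 i).val : ℝ) - ∑ i, latticeMomentum L k i * ((y'.2 i).val : ℝ)) := by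
  simp only [spaceTimePhase, matsubaraFreq_omega0, matsubaraFreq_omega0_rev]
  constructor <;> ring

/-- **The two testing phases differ by `2|sin θ|` in norm**, `θ = π (t₀ − t₁)/(2M)·(2M/β)·(β/2M) = π(j₀ − j₁)/(2M)`:
`‖conj(pw⁺pw⁻)(K₊) − conj(pw⁺pw⁻)(K₋)‖ = 2|sin((π/β)(t_{y} − t_{y′}))|`. -/
theorem norm_conj_phase_omega0_sub_rev [NeZero L] [NeZero M] (β : ℝ) (k : TorusSite 2 L) (y y' : SpaceTimeIdx L M) :
    ‖(starRingEnd ℂ) (hubbardPlaneWave L M β 0 (omega0 M, k) y * hubbardPlaneWave L M β 1 (omega0 M, k) y') -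
        (starRingEnd ℂ) (hubbardPlaneWave L M β 0 ((omega0 M).rev, k) y * hubbardPlaneWave L M β 1 ((omega0 M).rev, k) y')‖ =
      2 * |Real.sin (Real.pi / β * (imagTime β M y.1 - imagTime β M y'.1))| := by
  obtain ⟨h1, h2⟩ := spaceTimePhase_omega0_sub β k y y'
  set θ : ℝ := Real.pi / β * (imagTime β M y.1 - imagTime β M y'.1) with hθ
  set D : ℝ := ∑ i, latticeMomentum L k i * ((y.2 i).val : ℝ) - ∑ i, latticeMomentum L k i * ((y'.2 i).val : ℝ) with hD
  rw [conj_hubbardPlaneWave_zero_mul_one, conj_hubbardPlaneWave_zero_mul_one, h1, h2]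
  have hsplit : Complex.exp (((θ + D : ℝ) : ℂ) * I) - Complex.exp (((-θ + D : ℝ) : ℂ) * I) =
      Complex.exp ((D : ℂ) * I) * (Complex.exp ((θ : ℂ) * I) - Complex.exp (-(θ : ℂ) * I)) := by
    rw [mul_sub, ← Complex.exp_add, ← Complex.exp_add]
    congr 1 <;> (congr 1; push_cast; ring)
  rw [hsplit, norm_mul, Complex.norm_exp_ofReal_mul_I, one_mul, norm_cexp_mul_I_sub_cexp_neg_mul_I]

/-- **The time phase against the imaginary-time torus distance**: `2|sin((π/β)(t_j − t_{j′}))| ≤ (2π/β)·ε_x·circDist_{2M}(j, j′)`. -/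
theorem two_abs_sin_time_le [NeZero M] {β : ℝ} (hβ : 0 < β) (j j' : ImagTimeIdx M) :
    2 * |Real.sin (Real.pi / β * (imagTime β M j - imagTime β M j'))| ≤
      2 * (Real.pi / β) * (imagTimeWeight β M * (circDist (2 * M) j.val j'.val : ℝ)) := by
  have hM : 0 < 2 * M := j.pos
  have hMr : (0 : ℝ) < M := by
    have : 0 < M := Nat.pos_of_mul_pos_left hM
    exact_mod_cast this
  have harg : Real.pi / β * (imagTime β M j - imagTime β M j') = Real.pi * ((j.val : ℝ) - j'.val) / ((2 * M : ℕ) : ℝ) := by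
    simp only [imagTime]
    push_cast
    field_simp
  rw [harg]
  have h := abs_sin_pi_mul_sub_div_le_circDist hM j.isLt j'.isLt
  have hrhs : 2 * (Real.pi / β) * (imagTimeWeight β M * (circDist (2 * M) j.val j'.val : ℝ)) =
      2 * (Real.pi * (circDist (2 * M) j.val j'.val : ℝ) / ((2 * M : ℕ) : ℝ)) := by
    simp only [imagTimeWeight]
    push_cast
    field_simp
  rw [hrhs]
  linarith

/-- **THE FREQUENCY DIFFERENCE OF THE SELF-ENERGY AT `±ω₀` IS CONTROLLED BY THE TEMPORAL FIRST MOMENT of the position-space two-leg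
kernel**: for `β > 0`, any `G`, momentum `k⃗`, spin `σ`, if the (unsectorised) two-leg kernel `W(x₀, x₁)` of the string `(σ,+)(σ,−)`
satisfies `ε_x Σ_{x : x 0 = x₀} ε_x·circDist_{2M}(t₀, t₁)·‖W(x)‖ ≤ Mᵗ` for every `x₀`, then
`‖Σ(ω₀,k⃗,σ) − Σ(−ω₀,k⃗,σ)‖ ≤ 4(π/β)·Mᵗ`. [cite: BenfattoGiulianiMastropietro2006, §2.1 (2.4)–(2.5)] -/
theorem norm_selfEnergy_omega0_sub_rev_le_of_time_moment [NeZero L] [NeZero M] {β : ℝ} (hβ : 0 < β) (G : HubbardGrassmann L M)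
    (k : TorusSite 2 L) (σ : Fin 2) {Mt : ℝ}
    (hMt : ∀ x₀ : SpaceTimeIdx L M, imagTimeWeight β M *
      ∑ x ∈ (univ : Finset (Fin 2 → SpaceTimeIdx L M)).filter (fun x => x 0 = x₀),
        imagTimeWeight β M * (circDist (2 * M) (x 0).1.val (x 1).1.val : ℝ) *
          ‖sectorisedKernel L M β (trivialMultiplier L M) G 2 (![((0, σ), 0), ((0, σ), 1)] : Fin 2 → SectorLeg 1) x‖ ≤ Mt) :
    ‖selfEnergy L M β G (omega0 M, k) σ - selfEnergy L M β G ((omega0 M).rev, k) σ‖ ≤ 4 * (Real.pi / β) * Mt := by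
  set W := sectorisedKernel L M β (trivialMultiplier L M) G 2 (![((0, σ), 0), ((0, σ), 1)] : Fin 2 → SectorLeg 1) with hW
  set P : ℝ := (Fintype.card (SpaceTimeIdx L M) : ℝ) with hP
  have hPpos : 0 < P := by
    rw [hP]; exact_mod_cast (Fintype.card_pos_iff.2 ⟨(omega0 M, k)⟩ : 0 < Fintype.card (SpaceTimeIdx L M))
  have hε : 0 ≤ imagTimeWeight β M := imagTimeWeight_nonneg hβ.le M
  have hεP : imagTimeWeight β M * P = β * (L : ℝ) ^ 2 := imagTimeWeight_mul_card β L M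
  -- the difference of the two coefficients as one position-space sum
  have hdiff : (P : ℂ) ^ 2 * (kernel ℂ G 2 ![(((omega0 M, k), σ), 0), (((omega0 M, k), σ), 1)] -
      kernel ℂ G 2 ![((((omega0 M).rev, k), σ), 0), ((((omega0 M).rev, k), σ), 1)]) =
      ∑ x : Fin 2 → SpaceTimeIdx L M, W x *
        ((starRingEnd ℂ) (hubbardPlaneWave L M β 0 (omega0 M, k) (x 0) * hubbardPlaneWave L M β 1 (omega0 M, k) (x 1)) -
          (starRingEnd ℂ) (hubbardPlaneWave L M β 0 ((omega0 M).rev, k) (x 0) *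
            hubbardPlaneWave L M β 1 ((omega0 M).rev, k) (x 1))) := by
    have h1 := card_sq_mul_kernel_two_eq_sum hβ.ne' G (omega0 M, k) σ
    have h2 := card_sq_mul_kernel_two_eq_sum hβ.ne' G ((omega0 M).rev, k) σ
    have hPc : ((Fintype.card (SpaceTimeIdx L M) : ℕ) : ℂ) = (P : ℂ) := by rw [hP]; norm_cast
    rw [hPc] at h1 h2
    rw [mul_sub, h1, h2, ← sum_sub_distrib]
    exact sum_congr rfl fun x _ => by rw [hW]; ring
  -- norm of the position-space sum: `≤ Σ_x ‖W x‖ · (2π/β) ε circDist`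
  have hsum : ‖∑ x : Fin 2 → SpaceTimeIdx L M, W x *
        ((starRingEnd ℂ) (hubbardPlaneWave L M β 0 (omega0 M, k) (x 0) * hubbardPlaneWave L M β 1 (omega0 M, k) (x 1)) -
          (starRingEnd ℂ) (hubbardPlaneWave L M β 0 ((omega0 M).rev, k) (x 0) *
            hubbardPlaneWave L M β 1 ((omega0 M).rev, k) (x 1)))‖ ≤
      ∑ x : Fin 2 → SpaceTimeIdx L M, 2 * (Real.pi / β) *
        (imagTimeWeight β M * (circDist (2 * M) (x 0).1.val (x 1).1.val : ℝ) * ‖W x‖) := by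
    refine (norm_sum_le _ _).trans (sum_le_sum fun x _ => ?_)
    rw [norm_mul, norm_conj_phase_omega0_sub_rev]
    have h := two_abs_sin_time_le hβ (x 0).1 (x 1).1
    have hW0 : 0 ≤ ‖W x‖ := norm_nonneg _
    nlinarith
  -- slice by the position of leg 0 and use the hypothesis
  have hslice : ∑ x : Fin 2 → SpaceTimeIdx L M, 2 * (Real.pi / β) *
        (imagTimeWeight β M * (circDist (2 * M) (x 0).1.val (x 1).1.val : ℝ) * ‖W x‖) ≤
      2 * (Real.pi / β) * (P * Mt) / imagTimeWeight β M := by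
    have hεpos : 0 < imagTimeWeight β M := by
      unfold imagTimeWeight
      have : (0 : ℝ) < M := by
        have hM : 0 < 2 * M := (omega0 M).pos
        exact_mod_cast Nat.pos_of_mul_pos_left hM
      positivity
    rw [le_div_iff₀ hεpos, ← mul_sum]
    rw [← sum_fiberwise_of_maps_to (s := univ) (t := (univ : Finset (SpaceTimeIdx L M))) (g := fun x => x 0)
      (fun _ _ => mem_univ _)]
    have hP' : P * Mt = ∑ _x₀ : SpaceTimeIdx L M, Mt := by rw [sum_const, card_univ, nsmul_eq_mul, hP]
    rw [mul_assoc, hP', mul_comm (∑ x₀ ∈ univ, _) (imagTimeWeight β M), mul_sum]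
    refine mul_le_mul_of_nonneg_left (sum_le_sum fun x₀ _ => ?_) (by positivity)
    refine le_trans (le_of_eq ?_) (hMt x₀)
    rfl
  -- assemble: `Σ₊ − Σ₋ = 2βL²·(F₊ − F₋)`, `βL² = εP`
  rw [selfEnergy_eq_vertexFn, selfEnergy_eq_vertexFn, ← mul_sub, norm_mul, Complex.norm_real, Real.norm_eq_abs,
    abs_of_nonneg (by positivity)]
  have hker : ‖kernel ℂ G 2 ![(((omega0 M, k), σ), 0), (((omega0 M, k), σ), 1)] -
      kernel ℂ G 2 ![((((omega0 M).rev, k), σ), 0), ((((omega0 M).rev, k), σ), 1)]‖ ≤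
      2 * (Real.pi / β) * (P * Mt) / imagTimeWeight β M / P ^ 2 := by
    rw [le_div_iff₀ (by positivity), mul_comm]
    have h := congrArg (fun z : ℂ => ‖z‖) hdiff
    simp only [norm_mul, norm_pow, Complex.norm_real, Real.norm_eq_abs, abs_of_pos hPpos] at h
    rw [h]
    exact hsum.trans hslice
  have hεpos : 0 < imagTimeWeight β M := by
    unfold imagTimeWeight
    have : (0 : ℝ) < M := by
      have hM : 0 < 2 * M := (omega0 M).pos
      exact_mod_cast Nat.pos_of_mul_pos_left hM
    positivity
  calc 2 * (β * (L : ℝ) ^ 2) * ‖kernel ℂ G 2 ![(((omega0 M, k), σ), 0), (((omega0 M, k), σ), 1)] -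
        kernel ℂ G 2 ![((((omega0 M).rev, k), σ), 0), ((((omega0 M).rev, k), σ), 1)]‖
      ≤ 2 * (β * (L : ℝ) ^ 2) * (2 * (Real.pi / β) * (P * Mt) / imagTimeWeight β M / P ^ 2) :=
        mul_le_mul_of_nonneg_left hker (by positivity)
    _ = 4 * (Real.pi / β) * Mt := by
        rw [← hεP]
        field_simp
        ring

/-! ## §3 The field strength -/

/-- **(E3d) FROM THE TEMPORAL FIRST MOMENT, per spin**: under the hypothesis of `norm_selfEnergy_omega0_sub_rev_le_of_time_moment`,
`|z(k⃗,σ) − 1| ≤ 2·Mᵗ` (`z(k⃗,σ) = 1 − (Im Σ(ω₀) − Im Σ(−ω₀))/(2ω₀)`, `|Im a − Im b| ≤ ‖a − b‖`). No symmetry of `G` is used. -/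
theorem abs_fieldStrengthSpin_sub_one_le_of_time_moment [NeZero L] [NeZero M] {β : ℝ} (hβ : 0 < β) (G : HubbardGrassmann L M)
    (k : TorusSite 2 L) (σ : Fin 2) {Mt : ℝ}
    (hMt : ∀ x₀ : SpaceTimeIdx L M, imagTimeWeight β M *
      ∑ x ∈ (univ : Finset (Fin 2 → SpaceTimeIdx L M)).filter (fun x => x 0 = x₀),
        imagTimeWeight β M * (circDist (2 * M) (x 0).1.val (x 1).1.val : ℝ) *
          ‖sectorisedKernel L M β (trivialMultiplier L M) G 2 (![((0, σ), 0), ((0, σ), 1)] : Fin 2 → SectorLeg 1) x‖ ≤ Mt) :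
    |fieldStrengthSpin L M β G k σ - 1| ≤ 2 * Mt := by
  have h := norm_selfEnergy_omega0_sub_rev_le_of_time_moment hβ G k σ hMt
  have hω : 0 < 2 * (Real.pi / β) := by positivity
  rw [fieldStrengthSpin, sub_sub_cancel_left, abs_neg, abs_div, abs_of_pos hω, div_le_iff₀ hω]
  have him : |(selfEnergy L M β G (omega0 M, k) σ).im - (selfEnergy L M β G ((omega0 M).rev, k) σ).im| ≤
      ‖selfEnergy L M β G (omega0 M, k) σ - selfEnergy L M β G ((omega0 M).rev, k) σ‖ := by
    rw [← Complex.sub_im]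
    exact Complex.abs_im_le_norm _
  calc _ ≤ ‖selfEnergy L M β G (omega0 M, k) σ - selfEnergy L M β G ((omega0 M).rev, k) σ‖ := him
    _ ≤ 4 * (Real.pi / β) * Mt := h
    _ = 2 * Mt * (2 * (Real.pi / β)) := by ring

/-- **(E3d) for the spin-averaged field strength**: with the time-moment bound for both spin strings, `|z(k⃗) − 1| ≤ 2·Mᵗ`. -/
theorem abs_fieldStrength_sub_one_le_of_time_moment [NeZero L] [NeZero M] {β : ℝ} (hβ : 0 < β) (G : HubbardGrassmann L M)
    (k : TorusSite 2 L) {Mt : ℝ}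
    (hMt : ∀ (σ : Fin 2) (x₀ : SpaceTimeIdx L M), imagTimeWeight β M *
      ∑ x ∈ (univ : Finset (Fin 2 → SpaceTimeIdx L M)).filter (fun x => x 0 = x₀),
        imagTimeWeight β M * (circDist (2 * M) (x 0).1.val (x 1).1.val : ℝ) *
          ‖sectorisedKernel L M β (trivialMultiplier L M) G 2 (![((0, σ), 0), ((0, σ), 1)] : Fin 2 → SectorLeg 1) x‖ ≤ Mt) :
    |fieldStrength L M β G k - 1| ≤ 2 * Mt := by
  have h0 := abs_fieldStrengthSpin_sub_one_le_of_time_moment hβ G k 0 (hMt 0)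
  have h1 := abs_fieldStrengthSpin_sub_one_le_of_time_moment hβ G k 1 (hMt 1)
  rw [fieldStrength]
  have : (fieldStrengthSpin L M β G k 0 + fieldStrengthSpin L M β G k 1) / 2 - 1 =
      ((fieldStrengthSpin L M β G k 0 - 1) + (fieldStrengthSpin L M β G k 1 - 1)) / 2 := by ring
  rw [this, abs_div, abs_two]
  have htri := abs_add_le (fieldStrengthSpin L M β G k 0 - 1) (fieldStrengthSpin L M β G k 1 - 1)
  linarith

/-- **The slot form: (E3d) for the scale-`n` action of the cell.**  If the temporal first moment of the unsectorised position-space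
two-leg kernel of `klEffectiveAction … K klE0 n` (both spin strings, leg `0` pinned) is `≤ Mᵗ`, then `|klFieldStrength … n k⃗ − 1| ≤ 2·Mᵗ`
at every torus momentum — so the engine's (E3d) duty `|z_n − 1| ≤ cz|U|` on the shell is the time-moment bound `Mᵗ ≤ cz|U|/2`. -/
theorem abs_klFieldStrength_sub_one_le_of_time_moment [NeZero L] [NeZero M] {β : ℝ} (hβ : 0 < β) (U μ : ℝ) (K : TrigPolyC4v) (n : ℕ)
    (k : TorusSite 2 L) {Mt : ℝ}
    (hMt : ∀ (σ : Fin 2) (x₀ : SpaceTimeIdx L M), imagTimeWeight β M *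
      ∑ x ∈ (univ : Finset (Fin 2 → SpaceTimeIdx L M)).filter (fun x => x 0 = x₀),
        imagTimeWeight β M * (circDist (2 * M) (x 0).1.val (x 1).1.val : ℝ) *
          ‖sectorisedKernel L M β (trivialMultiplier L M)
            (KLProgrammeLegKernels.klEffectiveAction L M β U μ K klE0 n) 2 (![((0, σ), 0), ((0, σ), 1)] : Fin 2 → SectorLeg 1) x‖ ≤ Mt) :
    |klFieldStrength L M β U μ K n k - 1| ≤ 2 * Mt :=
  abs_fieldStrength_sub_one_le_of_time_moment hβ _ k hMt

end Summit.HubbardSuperconductivity.HubbardSuperconductivity.Theorems.TwoLegFourier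

end
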